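import Mathlib.Algebra.Order.Field.Basic
import Mathlib.Tactic.Ring
import Mathlib.Tactic.Linarith
import Mathlib.Tactic.LinearCombination
import Mathlib.Tactic.FieldSimp
import Mathlib.Tactic.Positivity
import Summits.Ventures.CertifiedArithmetic.LowPrec.SRRecursionVariance
import Summits.Ventures.CertifiedArithmetic.LowPrec.SRDoubleRounding
import Summits.Ventures.CertifiedArithmetic.LowPrec.SRSpacing
import Summits.Ventures.CertifiedArithmetic.LowPrec.SRCertificatesFP4
import HarnessLib

/-!
# Stochastic rounding into a finite format: affine RECURSIONS, III — SR versus the round-to-nearest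
# dead band; the exact cell law of the SR-EMA; every-format instances; FP4 kernel witnesses

HONEST FRAMING: certified error envelopes and provably optimal rounding/accumulation schemes for
low-precision formats under stated cost models; every table by two implementations; no hardware or
vendor claims.

File 3 of 3 on recursions `xₖ₊₁ = SR_F(a k · xₖ + b k)` (files `SRRecursion`, `SRRecursionVariance`).

* **Round-to-nearest dead band, any finite format, any tie rule** (`IsRN`, `rn_stuck`,
  `rn_stuck_of_sep`, `rnTraj_stuck`, `ema_rn_deadband`, `ema_rn_deadband_of_sep`): a deterministic
  recursion `yₖ₊₁ = RN(g k yₖ)` never leaves a grid point `y` whose exact updates are strictly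
  nearer to `y` than to any other grid point (sharp), in particular once `2·|g k y − y| < |f − y|`
  for every other grid point `f`; for the EMA of a constant `μ` with rate `β` every grid point `y`
  with `|μ − y| < sep_F(y)/(2|1−β|)` is ABSORBING — the estimate is stuck at `y ≠ μ` forever. This
  is the finite-format, arbitrary-spacing, tie-rule-free form of the fixed-point dead band
  `K = [0.5/(1−|a|)]` grid units of [Jackson1996] eq. (11.5.1) (uniform grid). Contrast: under SR
  `E[xₙ] = μ + βⁿ(x₀ − μ)` from every start (`recExp_ema_const`, file 1).
* **Exact cell law of the SR-EMA of a constant** (`ema_cell_law`, `ema_cell_probUp`): once the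
  SR-EMA state is one of the two neighbours `d = ⌊μ⌋_F < u = ⌈μ⌉_F` it stays in `{d, u}`, and for
  EVERY test function `f` and every `n`,
  `E f(xₙ) = f(d) + (p + βⁿ(t₀ − p))·(f(u) − f(d))`, `p = (μ − d)/(u − d)`, `t₀ = 1[x₀ = u]`:
  the law of `xₙ` relaxes GEOMETRICALLY AT RATE EXACTLY `β` to the one-step SR law of `μ` itself —
  in stationarity an SR-EMA of a constant is distributed exactly as a single stochastic rounding of
  the constant, for every rate `0 ≤ β ≤ 1`... (`β = 1`: frozen; `β = 0`: one SR per step). No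
  analogue of this identity was found in the literature searched (FRESHNESS-SR gen10).
* **Every format** (`valueSet_noSatR_of_window`, `valueSet_gapLER_of_window`,
  `valueSet_rec_mean_window`, `valueSet_rec_var_le_stationary_window`, `valueSet_gapLER_top`,
  `valueSet_rec_var_le_stationary_top`): if every pre-rounding value on every branch satisfies
  `|c| ≤ 2^(m+1+J)·quantum ≤ maxRat` then there is no saturation, `E[xₙ] = mₙ` exactly and, for
  contractions `|a k| ≤ β`, `β² < 1`, `Var[xₙ] ≤ (2^J·quantum)²/(4(1 − β²))` for all `n`; with the
  top-binade spacing `G = 2^(emaxCode−1)·quantum` the bound on `recVar` is unconditional.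
* **FP4 (E2M1) kernel witnesses** (`decide`): the RN-EMA with `β = 3/4` tracking `μ = 3/2` has dead
  band `⊇ {1, 3/2, 2, 3}` (stuck at `3`: relative error 100%, every tie rule), `4` is not absorbing;
  the SR-EMA from `x₀ = 3` has `E[x₃] = 273/128 = μ + (3/4)³(3 − μ)`, exact law
  `{3 ↦ 125/512, 2 ↦ 273/512, 3/2 ↦ 57/256}`, `Var[x₃] = 4623/16384 ≈ 0.282 ≤ 4/7` (the stationary
  bound with `G = 1`), and is absorbed at `μ = 3/2 ∈ F` (two-implementation exact tables:
  `certs/sr/gen10/`).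

References: [Jackson1996] §11.5 eq. (11.5.1) (dead band), §11.2 (noise gain); [KieburtzLawrenceMina1977]
(random quantisation removes limit cycles); [CrociGiles2022] Lemma 3.5 (RtN time stepping stagnates
for small `Δt`), Lemma 4.1; [OzkaraYuPark2025] §2 (stagnation of RN updates, SR random walk);
[ConnollyHighamMary2021] Lemma 4.4, (2.3) (the SR law).
-/

namespace Summit.Ventures.CertifiedArithmetic.LowPrec.SR

open Literature.ComputerArithmetic.ConnollyHighamMary2021
open Finset

section Generic

variable {K : Type*} [Field K] [LinearOrder K] [IsStrictOrderedRing K]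

/-! ### Round-to-nearest recursions: the dead band (any tie-breaking rule) -/

/-- `r` is a round-to-nearest image of `c` in `F`: a nearest element, ANY tie-breaking rule. -/
def IsRN (F : Finset K) (c r : K) : Prop := r ∈ F ∧ ∀ f ∈ F, |r - c| ≤ |f - c|

omit [IsStrictOrderedRing K] in
/-- Membership of a nearest rounding. -/
theorem IsRN.mem {F : Finset K} {c r : K} (h : IsRN F c r) : r ∈ F := h.1

/-- **Stuck step (sharp criterion).** If the exact update `c` is strictly nearer to the grid point
`y` than to every other grid point, then every nearest rounding of `c` is `y` (whatever the tie
rule) — and conversely a tie or a nearer point lets some tie rule leave `y`. -/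
theorem rn_stuck {F : Finset K} {c y : K} (hy : y ∈ F)
    (hnear : ∀ f ∈ F, f ≠ y → |c - y| < |c - f|) {r : K} (hr : IsRN F c r) : r = y := by
  by_contra hne
  have h1 : |r - c| ≤ |y - c| := hr.2 y hy
  have h2 : |c - y| < |c - r| := hnear r hr.1 hne
  rw [abs_sub_comm r c, abs_sub_comm y c] at h1
  linarith

/-- The classical sufficient form ([Jackson1996] §11.5): `2·|c − y| < |f − y|` for every other grid
point `f`. -/
theorem rn_stuck_of_sep {F : Finset K} {c y : K} (hy : y ∈ F)
    (hsep : ∀ f ∈ F, f ≠ y → 2 * |c - y| < |f - y|) {r : K} (hr : IsRN F c r) : r = y := by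
  refine rn_stuck hy (fun f hf hne => ?_) hr
  have h3 : |f - y| ≤ |f - c| + |c - y| := abs_sub_le f c y
  have h4 := hsep f hf hne
  rw [abs_sub_comm f c] at h3
  linarith

/-- A deterministic round-to-nearest trajectory of `yₖ₊₁ = RN(g k yₖ)` (any tie rule, possibly a
different one at every step). -/
def IsRNTraj (F : Finset K) (g : ℕ → K → K) (y : ℕ → K) : Prop :=
  ∀ k, IsRN F (g k (y k)) (y (k + 1))

/-- **Dead band.** A grid point `y₀` whose exact updates `g k y₀` are all strictly nearer to `y₀`
than to any other grid point is absorbing: the RN recursion started there never moves. -/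
theorem rnTraj_stuck {F : Finset K} {g : ℕ → K → K} {y : ℕ → K} (htraj : IsRNTraj F g y)
    (hy0 : y 0 ∈ F) (hdead : ∀ k, ∀ f ∈ F, f ≠ y 0 → |g k (y 0) - y 0| < |g k (y 0) - f|) :
    ∀ k, y k = y 0 := by
  intro k
  induction k with
  | zero => rfl
  | succ k ih =>
    have h := htraj k
    rw [ih] at h
    exact rn_stuck hy0 (hdead k) h

/-- **Dead band of the round-to-nearest EMA / first-order recursive filter** `y ← RN(β y + (1−β) μ)`
tracking a constant `μ` (sharp form): `y₀` is absorbing as soon as the exact update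
`c = β y₀ + (1−β) μ` is strictly nearer to `y₀` than to every other grid point — the estimate stays
at `y₀ ≠ μ` forever, for every tie rule. (Two-implementation census of the absorbing pairs `(μ, y₀)`
on FP4/FP6: `certs/sr/gen10/ema/RN_deadband_*`.) -/
theorem ema_rn_deadband {F : Finset K} {β μ : K} {y : ℕ → K}
    (htraj : IsRNTraj F (affMap (fun _ => β) (fun _ => (1 - β) * μ)) y) (hy0 : y 0 ∈ F)
    (hdead : ∀ f ∈ F, f ≠ y 0 → |β * y 0 + (1 - β) * μ - y 0| < |β * y 0 + (1 - β) * μ - f|) :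
    ∀ k, y k = y 0 :=
  rnTraj_stuck htraj hy0 (fun k f hf hne => by rw [affMap_apply]; exact hdead f hf hne)

/-- Dead band, classical sufficient form: `2|1−β|·|μ − y₀| < |f − y₀|` for every other grid point
`f`; with local separation `q` of `y₀` every grid point within `q/(2|1−β|)` of `μ` is absorbing —
on a grid of spacing `q` near `μ` the dead band has half-width `q/(2(1−β))`, i.e. `[0.5/(1−β)]` grid
units ([Jackson1996] (11.5.1)), versus NO dead band in the mean under SR (`recExp_ema_const`). -/
theorem ema_rn_deadband_of_sep {F : Finset K} {β μ : K} {y : ℕ → K}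
    (htraj : IsRNTraj F (affMap (fun _ => β) (fun _ => (1 - β) * μ)) y) (hy0 : y 0 ∈ F)
    (hsep : ∀ f ∈ F, f ≠ y 0 → 2 * (|1 - β| * |μ - y 0|) < |f - y 0|) : ∀ k, y k = y 0 := by
  refine rnTraj_stuck htraj hy0 (fun k f hf hne => ?_)
  have e : affMap (fun _ => β) (fun _ => (1 - β) * μ) k (y 0) - y 0 = (1 - β) * (μ - y 0) := by
    rw [affMap_apply]; ring
  have h3 : |f - y 0| ≤ |f - affMap (fun _ => β) (fun _ => (1 - β) * μ) k (y 0)|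
      + |affMap (fun _ => β) (fun _ => (1 - β) * μ) k (y 0) - y 0| := abs_sub_le _ _ _
  have h4 := hsep f hf hne
  rw [abs_sub_comm f (affMap (fun _ => β) (fun _ => (1 - β) * μ) k (y 0)), e, abs_mul] at h3
  rw [e, abs_mul]
  linarith

/-! ### The SR-EMA of a constant: exact law inside the cell of `μ` -/

/-- **Exact cell law of the SR-EMA of a constant signal.** Let `μ` lie in the hull with proper cell
`d = ⌊μ⌋_F < u = ⌈μ⌉_F`, `0 ≤ β ≤ 1`, and start at `x₀ ∈ {d, u}`. Then the state never leaves
`{d, u}` and for every test function `f` and every `n`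
`E f(xₙ) = f(d) + (p + βⁿ·(t₀ − p))·(f(u) − f(d))`, `p = (μ − d)/(u − d)` (the SR probability of
`μ` itself), `t₀ = (x₀ − d)/(u − d) = 1[x₀ = u]`. Equivalently `P(xₙ = u) = p + βⁿ(1[x₀=u] − p)`:
geometric relaxation at rate exactly `β` to the ONE-STEP SR LAW OF `μ`, which is the stationary law
for every `β < 1`. -/
theorem ema_cell_law {F : Finset K} {μ : K} (hμ : InHull F μ) (hcell : dn F μ < up F μ) {β : K}
    (hβ0 : 0 ≤ β) (hβ1 : β ≤ 1) (f : K → K) (n : ℕ) {y : K} (hy : y = dn F μ ∨ y = up F μ) :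
    recExp F (affMap (fun _ => β) (fun _ => (1 - β) * μ)) n f y
      = f (dn F μ) + ((μ - dn F μ) / (up F μ - dn F μ)
          + β ^ n * ((y - dn F μ) / (up F μ - dn F μ) - (μ - dn F μ) / (up F μ - dn F μ)))
          * (f (up F μ) - f (dn F μ)) := by
  have hne : up F μ - dn F μ ≠ 0 := sub_ne_zero.mpr (ne_of_gt hcell)
  have hdμ : dn F μ ≤ μ := (dn_le_clamp F μ).trans (clamp_eq_self hμ).le
  have hμu : μ ≤ up F μ := (clamp_eq_self hμ).ge.trans (clamp_le_up F μ)
  induction n generalizing y with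
  | zero =>
    rcases hy with rfl | rfl
    · simp only [recExp, pow_zero, one_mul, sub_self, zero_div]; ring
    · simp only [recExp, pow_zero, one_mul, div_self hne]; ring
  | succ n ih =>
    have hyd : dn F μ ≤ y := by rcases hy with rfl | rfl; exacts [le_rfl, hcell.le]
    have hyu : y ≤ up F μ := by rcases hy with rfl | rfl; exacts [hcell.le, le_rfl]
    have h1 : dn F μ ≤ β * y + (1 - β) * μ := by
      nlinarith [mul_nonneg hβ0 (sub_nonneg.2 hyd), mul_nonneg (sub_nonneg.2 hβ1) (sub_nonneg.2 hdμ)]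
    have h2 : β * y + (1 - β) * μ ≤ up F μ := by
      nlinarith [mul_nonneg hβ0 (sub_nonneg.2 hyu), mul_nonneg (sub_nonneg.2 hβ1) (sub_nonneg.2 hμu)]
    simp only [recExp, affMap_succ, affMap_apply]
    rw [step_eq_affine hμ h1 h2, ih (Or.inl rfl), ih (Or.inr rfl)]
    simp only [sub_self, zero_div, div_self hne, pow_succ]
    field_simp
    ring

/-- The cell law for the indicator of the upper neighbour: `P(xₙ = ⌈μ⌉) = p + βⁿ(1[x₀ = ⌈μ⌉] − p)`
with `p = (μ − ⌊μ⌋)/(⌈μ⌉ − ⌊μ⌋)`; started AT the upper neighbour: `p + βⁿ(1 − p)`. -/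
theorem ema_cell_probUp {F : Finset K} {μ : K} (hμ : InHull F μ) (hcell : dn F μ < up F μ) {β : K}
    (hβ0 : 0 ≤ β) (hβ1 : β ≤ 1) (n : ℕ) :
    recExp F (affMap (fun _ => β) (fun _ => (1 - β) * μ)) n
        (fun v => if v = up F μ then 1 else 0) (up F μ)
      = (μ - dn F μ) / (up F μ - dn F μ) + β ^ n * (1 - (μ - dn F μ) / (up F μ - dn F μ)) := by
  have hne : up F μ - dn F μ ≠ 0 := sub_ne_zero.mpr (ne_of_gt hcell)
  have h1 : (if up F μ = up F μ then (1 : K) else 0) = 1 := if_pos rfl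
  have h2 : (if dn F μ = up F μ then (1 : K) else 0) = 0 := if_neg (ne_of_lt hcell)
  rw [ema_cell_law hμ hcell hβ0 hβ1 _ n (Or.inr rfl), h1, h2, div_self hne]
  ring

/-- In particular the MEAN inside the cell is `μ + βⁿ(x₀ − μ)` (consistent with `recExp_ema_const`)
and the VARIANCE is `Pₙ(1 − Pₙ)(u − d)²`, `Pₙ = P(xₙ = u)`, converging to `(μ − d)(u − μ) = v_F(μ)`:
the stationary jitter of an SR-EMA of a constant is the one-step SR variance of the constant —
`≤ G²/4`, independent of `β` (compare the general bound `G²/(4(1−β²))` of `recVar_le_stationary`,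
which covers time-varying inputs). Here: the mean, from the cell law. -/
theorem ema_cell_mean {F : Finset K} {μ : K} (hμ : InHull F μ) (hcell : dn F μ < up F μ) {β : K}
    (hβ0 : 0 ≤ β) (hβ1 : β ≤ 1) (n : ℕ) {y : K} (hy : y = dn F μ ∨ y = up F μ) :
    recExp F (affMap (fun _ => β) (fun _ => (1 - β) * μ)) n (fun t => t) y = μ + β ^ n * (y - μ) := by
  have hne : up F μ - dn F μ ≠ 0 := sub_ne_zero.mpr (ne_of_gt hcell)
  rw [ema_cell_law hμ hcell hβ0 hβ1 _ n hy]
  field_simp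
  ring

end Generic

/-! ### Every format: window ⇒ no saturation, small gaps, exact mean, stationary variance -/

section Formats

open Literature.ComputerArithmetic.FloatingPoint

/-- Window ⇒ no branch saturates (`W ≤ maxRat`). -/
theorem valueSet_noSatR_of_window (φ : Format) {W : ℚ} (hW : W ≤ φ.maxRat) (g : ℕ → ℚ → ℚ)
    (n : ℕ) (s : ℚ) (h : PreAll (MiniFloat.valueSet φ) g n (fun c => |c| ≤ W) s) :
    NoSatR (MiniFloat.valueSet φ) g n s :=
  preAll_mono _ g n (fun c hc => (valueSet_inHull_iff φ c).mpr (hc.trans hW)) s h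

/-- Window `|c| ≤ 2^(m+1+J)·quantum ≤ maxRat` on every branch ⇒ `GapLER (2^J·quantum)`. -/
theorem valueSet_gapLER_of_window (φ : Format) {J : ℕ}
    (hmax : 2 ^ (φ.manBits + 1 + J) ≤ φ.maxScaled) (g : ℕ → ℚ → ℚ) (n : ℕ) (s : ℚ)
    (h : PreAll (MiniFloat.valueSet φ) g n (fun c => |c| ≤ 2 ^ (φ.manBits + 1 + J) * φ.quantum) s) :
    GapLER (MiniFloat.valueSet φ) (2 ^ J * φ.quantum) g n s := by
  refine preAll_mono _ g n (fun c hc => ?_) s h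
  have hle : |c| ≤ φ.maxRat :=
    hc.trans (mul_le_mul_of_nonneg_right (by exact_mod_cast hmax) φ.quantum_pos.le)
  have e : clamp (MiniFloat.valueSet φ) c = c := clamp_eq_self ((valueSet_inHull_iff φ c).mpr hle)
  simp only [e]
  exact valueSet_gap_le_window φ hmax hc

/-- **Exact mean on a window, every format**: `E[xₙ] = mₙ` (the unrounded trajectory). -/
theorem valueSet_rec_mean_window (φ : Format) {J : ℕ}
    (hmax : 2 ^ (φ.manBits + 1 + J) ≤ φ.maxScaled) (a b : ℕ → ℚ) (n : ℕ) (s : ℚ)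
    (h : PreAll (MiniFloat.valueSet φ) (affMap a b) n
      (fun c => |c| ≤ 2 ^ (φ.manBits + 1 + J) * φ.quantum) s) :
    recExp (MiniFloat.valueSet φ) (affMap a b) n (fun t => t) s = affMean a b n s :=
  recExp_affMap_id_of_noSatR _ a b n s (valueSet_noSatR_of_window φ
    (mul_le_mul_of_nonneg_right (by exact_mod_cast hmax) φ.quantum_pos.le) _ n s h)

/-- **Stationary variance bound on a window, every format**: for contractions `|a k| ≤ β`,
`β² < 1`: `Var[xₙ] ≤ (2^J·quantum)²/(4(1 − β²))` for every `n`. -/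
theorem valueSet_rec_var_le_stationary_window (φ : Format) {J : ℕ}
    (hmax : 2 ^ (φ.manBits + 1 + J) ≤ φ.maxScaled) (a b : ℕ → ℚ) {β : ℚ} (hβ : ∀ k, |a k| ≤ β)
    (hβ1 : β ^ 2 < 1) (n : ℕ) (s : ℚ)
    (h : PreAll (MiniFloat.valueSet φ) (affMap a b) n
      (fun c => |c| ≤ 2 ^ (φ.manBits + 1 + J) * φ.quantum) s) :
    recExp (MiniFloat.valueSet φ) (affMap a b) n (fun t => (t - affMean a b n s) ^ 2) s
      ≤ (2 ^ J * φ.quantum) ^ 2 / (4 * (1 - β ^ 2)) :=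
  recExp_affMap_var_le_stationary _ _ a b hβ hβ1 n s
    (valueSet_noSatR_of_window φ
      (mul_le_mul_of_nonneg_right (by exact_mod_cast hmax) φ.quantum_pos.le) _ n s h)
    (valueSet_gapLER_of_window φ hmax _ n s h)

/-- `GapLER (2^(emaxCode−1)·quantum)` (the top-binade spacing) along every branch, unconditionally. -/
theorem valueSet_gapLER_top (φ : Format) (g : ℕ → ℚ → ℚ) (n : ℕ) (s : ℚ) :
    GapLER (MiniFloat.valueSet φ) (2 ^ (φ.emaxCode - 1) * φ.quantum) g n s :=
  gapLER_of_hull (MiniFloat.valueSet_nonempty φ) (fun _ hc => valueSet_gap_le_top φ hc) g n s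

/-- **Global stationary bound, every format**: for `|a k| ≤ β`, `β² < 1`, unconditionally
`recVar ≤ G²/(4(1−β²))`, `G = 2^(emaxCode−1)·quantum`, for every `n` (and `Var[xₙ] = recVar` as
soon as no branch saturates, `recExp_affMap_var`). -/
theorem valueSet_rec_var_le_stationary_top (φ : Format) (a b : ℕ → ℚ) {β : ℚ} (hβ : ∀ k, |a k| ≤ β)
    (hβ1 : β ^ 2 < 1) (n : ℕ) (s : ℚ) :
    recVar (MiniFloat.valueSet φ) a b n s
      ≤ (2 ^ (φ.emaxCode - 1) * φ.quantum) ^ 2 / (4 * (1 - β ^ 2)) :=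
  recVar_le_stationary _ _ a b hβ hβ1 n s (valueSet_gapLER_top φ _ n s)

end Formats

/-! ### FP4 (E2M1) kernel witnesses -/

namespace FP4

/-- The RN-EMA `y ← RN(3/4·y + 1/4·3/2)` in E2M1 has dead band `⊇ {1, 3/2, 2, 3}`: each of these
grid points satisfies the separation criterion of `ema_rn_deadband_of_sep` (every tie rule). Tracking
`μ = 3/2` from `y₀ = 3` it stays at `3` forever. -/
theorem e2m1_ema_deadband : ∀ y ∈ ({1, 3/2, 2, 3} : Finset ℚ), y ∈ e2m1 ∧
    ∀ f ∈ e2m1, f ≠ y → 2 * (|1 - (3/4 : ℚ)| * |3/2 - y|) < |f - y| := by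
  decide +kernel

/-- … while `4` is NOT absorbing (the criterion fails at `f = 3`; indeed `RN(3.375) = 3`). -/
theorem e2m1_ema_deadband_four : ¬ ∀ f ∈ e2m1, f ≠ 4 → 2 * (|1 - (3/4 : ℚ)| * |3/2 - 4|) < |f - 4| := by
  decide +kernel

/-- Any RN trajectory of this EMA started in the dead band is constant (instance of
`ema_rn_deadband_of_sep`; e.g. `y₀ = 3`: the estimate of `μ = 3/2` is `3` forever). -/
theorem e2m1_ema_rn_stuck {y : ℕ → ℚ} (htraj : IsRNTraj e2m1 (affMap (fun _ => 3/4)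
    (fun _ => (1 - 3/4) * (3/2))) y) (hy0 : y 0 ∈ ({1, 3/2, 2, 3} : Finset ℚ)) : ∀ k, y k = y 0 := by
  obtain ⟨hmem, hsep⟩ := e2m1_ema_deadband (y 0) hy0
  exact ema_rn_deadband_of_sep htraj hmem hsep

/-- The SR-EMA with the same data from `x₀ = 3`: no branch saturates and all gaps are `≤ 1` up to
`n = 4`. -/
theorem e2m1_ema_sr_hyps : NoSatR e2m1 (affMap (fun _ => 3/4) (fun _ => (1 - 3/4) * (3/2))) 4 3 ∧
    GapLER e2m1 1 (affMap (fun _ => 3/4) (fun _ => (1 - 3/4) * (3/2))) 4 3 := by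
  decide +kernel

/-- SR-EMA exact mean `E[x₃] = 273/128 = 3/2 + (3/4)³·(3 − 3/2)` (kernel evaluation; the general
theorem is `recExp_ema_const`). -/
theorem e2m1_ema_sr_mean3 :
    recExp e2m1 (affMap (fun _ => 3/4) (fun _ => (1 - 3/4) * (3/2))) 3 (fun t => t) 3 = 273 / 128 := by
  decide +kernel

/-- SR-EMA exact law at `n = 3`: `P(x₃ = 3) = 125/512`, `P(x₃ = 2) = 273/512`, `P(x₃ = 3/2) = 57/256`
(two-implementation table `certs/sr/gen10/ema_e2m1`). -/
theorem e2m1_ema_sr_law3 :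
    recExp e2m1 (affMap (fun _ => 3/4) (fun _ => (1 - 3/4) * (3/2))) 3
        (fun v => if v = 3 then 1 else 0) 3 = 125 / 512 ∧
    recExp e2m1 (affMap (fun _ => 3/4) (fun _ => (1 - 3/4) * (3/2))) 3
        (fun v => if v = 2 then 1 else 0) 3 = 273 / 512 ∧
    recExp e2m1 (affMap (fun _ => 3/4) (fun _ => (1 - 3/4) * (3/2))) 3
        (fun v => if v = 3/2 then 1 else 0) 3 = 57 / 256 := by
  decide +kernel

/-- SR-EMA exact variance `Var[x₃] = 4623/16384 (≈ 0.282)`, against the stationary envelope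
`G²/(4(1−β²)) = 4/7` of `recVar_le_stationary` (`G = 1`, `β = 3/4`). -/
theorem e2m1_ema_sr_var3 :
    recVar e2m1 (fun _ => 3/4) (fun _ => (1 - 3/4) * (3/2)) 3 3 = 4623 / 16384 ∧
    (4623 / 16384 : ℚ) ≤ 1 ^ 2 / (4 * (1 - (3/4) ^ 2)) := by
  refine ⟨by decide +kernel, by norm_num⟩

end FP4

end Summit.Ventures.CertifiedArithmetic.LowPrec.SR
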